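import Literature.Probability.LatticeModels.StrongHarrisKleitman
import HarnessLib

/-!
# `NoHeavyLowerTail` (stmt-CriticalPhenomena-4575) — the MONOTONE POLARIZED strong Harris inequality, I:
# the induction step (real arithmetic), Gladkov's transition data of one system, the cross-condition
# (E3GRP-by-switching line, strategy 3, cell `prim-e3grp`, seat `prim-e3grp-switch-3` gen 2)

Support file (`--supports stmt-CriticalPhenomena-4575`).  Part I of two; the theorem and its documentation
are in `…MonotonePolarizedStrongHarris` (Part II).  NEW RESULT of this programme (not a published
statement): a two-measure ("polarized") strengthening of Gladkov's strong Harris–Kleitman inequality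
(`Literature.Probability.LatticeModels.prodBernoulli_strongHarris`, Gladkov 2024 Thm. 2.1 = the diagonal
case).  This part contains the three ingredients of the induction on coordinates for PAIRS of Gladkov
systems `(A, (C i), B)`, `(A', (C' i), B')` under two product measures `prodBernoulli p`, `prodBernoulli p'`
with `p' ≤ p`:
* `step_arith` — exposing one coordinate with weights `(p_e, p'_e)`, `p'_e ≤ p_e`, the defect of the pair is
  `(1 − p_e) g₀₀ + p'_e g₁₁ + (p_e − p'_e) g₁₀ + (1 − p_e) p'_e G` with
  `G ≥ Σ_i (t_i v'_i + v_i t'_i) + Σ_{i ≠ j} (v_i v'_j + t_i t'_j) ≥ 0` in Gladkov's transition masses;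
* `sectionData` — Gladkov's cells `u, v, t` of ONE system along one coordinate (verbatim the bookkeeping of
  the tree proof of Thm. 2.1, isolated as a lemma so that it can be applied to both systems);
* `cross_self`, `cross_sections` — the cross-condition "no `ω' ≤ ω` with `ω ∈ C i`, `ω' ∈ C' j`, `i ≠ j`"
  holds for `S' = S` and is inherited by the three section pairs (upper,upper), (lower,lower), (upper,lower).
-/

noncomputable section

namespace Summit.CriticalPhenomena.PercolationContinuityZ3.Theorems

open MeasureTheory Measure
open Literature.Probability.LatticeModels Literature.Probability.LatticeModels.StrongHarris
open Literature.Probability.Percolation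

variable {ι : Type*}

namespace MonotonePolarizedStrongHarris

/-! ### Real arithmetic of the induction step -/

/-- `Σ_i x_i y_i ≤ (Σ x)(Σ y)` for nonnegative reals. [folklore] -/
theorem sum_mul_le_sum_mul_sum {κ : Type*} (s : Finset κ) (x y : κ → ℝ)
    (hx : ∀ i ∈ s, 0 ≤ x i) (hy : ∀ i ∈ s, 0 ≤ y i) :
    ∑ i ∈ s, x i * y i ≤ (∑ i ∈ s, x i) * (∑ i ∈ s, y i) := by
  rw [Finset.sum_mul]
  refine Finset.sum_le_sum fun i hi => ?_
  exact mul_le_mul_of_nonneg_left (Finset.single_le_sum hy hi) (hx i hi)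

set_option maxHeartbeats 800000 in
/-- **The polarized induction step, as real arithmetic.**  Two systems with Gladkov transition data
(`c¹ = u + v`, `c⁰ = u + t`, `a₁ ≥ a₀ + Σ t`, `b₀ ≥ b₁ + Σ v`, and primed), weights `p' ≤ p` in `[0,1]`;
with `g αβ := a_α b'_β + a'_β b_α − [(Σ c^α)(Σ c'^β) − Σ_i c^α_i c'^β_i]`, the hypotheses
`g₀₀, g₁₁, g₁₀ ≥ 0` give `g ≥ 0` for the two convex combinations. [this work] -/
theorem step_arith {κ : Type*} (s : Finset κ) {p q a₁ a₀ b₁ b₀ a₁' a₀' b₁' b₀' : ℝ}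
    {u v t u' v' t' : κ → ℝ}
    (hq0 : 0 ≤ q) (hqp : q ≤ p) (hp1 : p ≤ 1)
    (hv : ∀ i ∈ s, 0 ≤ v i) (ht : ∀ i ∈ s, 0 ≤ t i) (hv' : ∀ i ∈ s, 0 ≤ v' i) (ht' : ∀ i ∈ s, 0 ≤ t' i)
    (ha : a₀ + ∑ i ∈ s, t i ≤ a₁) (hb : b₁ + ∑ i ∈ s, v i ≤ b₀)
    (ha' : a₀' + ∑ i ∈ s, t' i ≤ a₁') (hb' : b₁' + ∑ i ∈ s, v' i ≤ b₀')
    (g₀₀ : (∑ i ∈ s, (u i + t i)) * (∑ i ∈ s, (u' i + t' i)) - ∑ i ∈ s, (u i + t i) * (u' i + t' i) ≤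
      a₀ * b₀' + a₀' * b₀)
    (g₁₁ : (∑ i ∈ s, (u i + v i)) * (∑ i ∈ s, (u' i + v' i)) - ∑ i ∈ s, (u i + v i) * (u' i + v' i) ≤
      a₁ * b₁' + a₁' * b₁)
    (g₁₀ : (∑ i ∈ s, (u i + v i)) * (∑ i ∈ s, (u' i + t' i)) - ∑ i ∈ s, (u i + v i) * (u' i + t' i) ≤
      a₁ * b₀' + a₀' * b₁) :
    (∑ i ∈ s, (p * (u i + v i) + (1 - p) * (u i + t i))) *
          (∑ i ∈ s, (q * (u' i + v' i) + (1 - q) * (u' i + t' i))) -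
        ∑ i ∈ s, (p * (u i + v i) + (1 - p) * (u i + t i)) * (q * (u' i + v' i) + (1 - q) * (u' i + t' i)) ≤
      (p * a₁ + (1 - p) * a₀) * (q * b₁' + (1 - q) * b₀') +
        (q * a₁' + (1 - q) * a₀') * (p * b₁ + (1 - p) * b₀) := by
  -- atoms
  set C₁ := ∑ i ∈ s, (u i + v i) with hC₁
  set C₀ := ∑ i ∈ s, (u i + t i) with hC₀
  set C₁' := ∑ i ∈ s, (u' i + v' i) with hC₁'
  set C₀' := ∑ i ∈ s, (u' i + t' i) with hC₀'
  set S₁₁ := ∑ i ∈ s, (u i + v i) * (u' i + v' i) with hS₁₁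
  set S₁₀ := ∑ i ∈ s, (u i + v i) * (u' i + t' i) with hS₁₀
  set S₀₁ := ∑ i ∈ s, (u i + t i) * (u' i + v' i) with hS₀₁
  set S₀₀ := ∑ i ∈ s, (u i + t i) * (u' i + t' i) with hS₀₀
  set T := ∑ i ∈ s, t i with hT
  set W := ∑ i ∈ s, v i with hW
  set T' := ∑ i ∈ s, t' i with hT'
  set W' := ∑ i ∈ s, v' i with hW'
  -- the convex combinations in terms of the atoms
  have e1 : ∑ i ∈ s, (p * (u i + v i) + (1 - p) * (u i + t i)) = p * C₁ + (1 - p) * C₀ := by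
    rw [hC₁, hC₀, Finset.mul_sum, Finset.mul_sum, ← Finset.sum_add_distrib]
  have e1' : ∑ i ∈ s, (q * (u' i + v' i) + (1 - q) * (u' i + t' i)) = q * C₁' + (1 - q) * C₀' := by
    rw [hC₁', hC₀', Finset.mul_sum, Finset.mul_sum, ← Finset.sum_add_distrib]
  have e2 : ∑ i ∈ s, (p * (u i + v i) + (1 - p) * (u i + t i)) * (q * (u' i + v' i) + (1 - q) * (u' i + t' i)) =
      p * q * S₁₁ + p * (1 - q) * S₁₀ + (1 - p) * q * S₀₁ + (1 - p) * (1 - q) * S₀₀ := by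
    rw [hS₁₁, hS₁₀, hS₀₁, hS₀₀, Finset.mul_sum, Finset.mul_sum, Finset.mul_sum, Finset.mul_sum,
      ← Finset.sum_add_distrib, ← Finset.sum_add_distrib, ← Finset.sum_add_distrib]
    exact Finset.sum_congr rfl fun i _ => by ring
  -- differences of the atoms in terms of the transition masses
  have e3 : C₁ - C₀ = W - T := by
    rw [hC₁, hC₀, hW, hT, ← Finset.sum_sub_distrib, ← Finset.sum_sub_distrib]
    exact Finset.sum_congr rfl fun i _ => by ring
  have e3' : C₁' - C₀' = W' - T' := by
    rw [hC₁', hC₀', hW', hT', ← Finset.sum_sub_distrib, ← Finset.sum_sub_distrib]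
    exact Finset.sum_congr rfl fun i _ => by ring
  have e4 : S₁₁ - S₁₀ - S₀₁ + S₀₀ = ∑ i ∈ s, (v i - t i) * (v' i - t' i) := by
    rw [hS₁₁, hS₁₀, hS₀₁, hS₀₀, ← Finset.sum_sub_distrib, ← Finset.sum_sub_distrib,
      ← Finset.sum_add_distrib]
    exact Finset.sum_congr rfl fun i _ => by ring
  -- `Σ (v - t)(v' - t') ≤ W W' + T T'`
  have h5 : ∑ i ∈ s, (v i - t i) * (v' i - t' i) ≤ W * W' + T * T' := by
    calc ∑ i ∈ s, (v i - t i) * (v' i - t' i) ≤ ∑ i ∈ s, (v i * v' i + t i * t' i) :=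
          Finset.sum_le_sum fun i hi => by
            have h1 : 0 ≤ v i * t' i := mul_nonneg (hv i hi) (ht' i hi)
            have h2 : 0 ≤ t i * v' i := mul_nonneg (ht i hi) (hv' i hi)
            have h3 : (v i - t i) * (v' i - t' i) = v i * v' i + t i * t' i - (v i * t' i + t i * v' i) := by
              ring
            rw [h3]; linarith
      _ = ∑ i ∈ s, v i * v' i + ∑ i ∈ s, t i * t' i := Finset.sum_add_distrib
      _ ≤ W * W' + T * T' := add_le_add (sum_mul_le_sum_mul_sum s v v' hv hv')
          (sum_mul_le_sum_mul_sum s t t' ht ht')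
  have hT0 : 0 ≤ T := Finset.sum_nonneg ht
  have hW0 : 0 ≤ W := Finset.sum_nonneg hv
  have hT0' : 0 ≤ T' := Finset.sum_nonneg ht'
  have hW0' : 0 ≤ W' := Finset.sum_nonneg hv'
  -- the mixed second difference `G = g₁₀ + g₀₁ - g₀₀ - g₁₁` (as values of RHS - LHS) is nonnegative
  set G := -((a₁ - a₀) * (b₁' - b₀')) - (a₁' - a₀') * (b₁ - b₀) + (C₁ - C₀) * (C₁' - C₀') -
    (S₁₁ - S₁₀ - S₀₁ + S₀₀) with hG
  have hG0 : 0 ≤ G := by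
    have h6 : T * W' ≤ -((a₁ - a₀) * (b₁' - b₀')) := by
      have h6a : T ≤ a₁ - a₀ := by linarith
      have h6b : W' ≤ b₀' - b₁' := by linarith
      have h6c : T * W' ≤ (a₁ - a₀) * W' := mul_le_mul_of_nonneg_right h6a hW0'
      have h6d : (a₁ - a₀) * W' ≤ (a₁ - a₀) * (b₀' - b₁') :=
        mul_le_mul_of_nonneg_left h6b (by linarith)
      have h6e : -((a₁ - a₀) * (b₁' - b₀')) = (a₁ - a₀) * (b₀' - b₁') := by ring
      rw [h6e]; exact h6c.trans h6d
    have h7 : T' * W ≤ -((a₁' - a₀') * (b₁ - b₀)) := by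
      have h7a : T' ≤ a₁' - a₀' := by linarith
      have h7b : W ≤ b₀ - b₁ := by linarith
      have h7c : T' * W ≤ (a₁' - a₀') * W := mul_le_mul_of_nonneg_right h7a hW0
      have h7d : (a₁' - a₀') * W ≤ (a₁' - a₀') * (b₀ - b₁) :=
        mul_le_mul_of_nonneg_left h7b (by linarith)
      have h7e : -((a₁' - a₀') * (b₁ - b₀)) = (a₁' - a₀') * (b₀ - b₁) := by ring
      rw [h7e]; exact h7c.trans h7d
    have h8 : (W - T) * (W' - T') = W * W' + T * T' - (W * T' + T * W') := by ring
    rw [hG, e3, e3', e4, h8]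
    linarith [h5, h6, h7]
  -- `RHS - LHS = (1-p) g₀₀ + q g₁₁ + (p-q) g₁₀ + (1-p) q G`
  have key : (p * a₁ + (1 - p) * a₀) * (q * b₁' + (1 - q) * b₀') +
        (q * a₁' + (1 - q) * a₀') * (p * b₁ + (1 - p) * b₀) -
      ((p * C₁ + (1 - p) * C₀) * (q * C₁' + (1 - q) * C₀') -
        (p * q * S₁₁ + p * (1 - q) * S₁₀ + (1 - p) * q * S₀₁ + (1 - p) * (1 - q) * S₀₀)) =
      (1 - p) * (a₀ * b₀' + a₀' * b₀ - (C₀ * C₀' - S₀₀)) + q * (a₁ * b₁' + a₁' * b₁ - (C₁ * C₁' - S₁₁)) +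
        (p - q) * (a₁ * b₀' + a₀' * b₁ - (C₁ * C₀' - S₁₀)) + (1 - p) * q * G := by
    rw [hG]; ring
  rw [e1, e1', e2]
  have h8 : 0 ≤ (1 - p) * (a₀ * b₀' + a₀' * b₀ - (C₀ * C₀' - S₀₀)) := mul_nonneg (by linarith) (by linarith)
  have h9 : 0 ≤ q * (a₁ * b₁' + a₁' * b₁ - (C₁ * C₁' - S₁₁)) := mul_nonneg hq0 (by linarith)
  have h10 : 0 ≤ (p - q) * (a₁ * b₀' + a₀' * b₁ - (C₁ * C₀' - S₁₀)) := mul_nonneg (by linarith) (by linarith)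
  have h11 : 0 ≤ (1 - p) * q * G := mul_nonneg (mul_nonneg (by linarith) hq0) hG0
  linarith [key, h8, h9, h10, h11]

/-! ### Transition data of one Gladkov system along one coordinate -/

/-- **Gladkov's cells for one system** (his `C_i^∘, C_i^-, C_i^+` and the inclusions `A⁰ ⊔ ⋃ C_i^+ ⊆ A¹`,
`B¹ ⊔ ⋃ C_i^- ⊆ B⁰`): for a Gladkov system of cylinder events over `insert e F'` there are
`u, v, t ≥ 0` with `μ(C_i¹) = u_i + v_i`, `μ(C_i⁰) = u_i + t_i`, `μ(A⁰) + Σ t ≤ μ(A¹)`,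
`μ(B¹) + Σ v ≤ μ(B⁰)` (sections `X¹ = insert e ⁻¹' X`, `X⁰ = (· ∖ {e}) ⁻¹' X`).
[cite: Gladkov2024StrongFKG, proof of Thm. 2.1] -/
theorem sectionData [DecidableEq ι] (p : ι → unitInterval) {κ : Type*} (s : Finset κ) (e : ι)
    (F' : Finset ι) {A B : Set (Set ι)} {C : κ → Set (Set ι)}
    (hdisj : ∀ i ∈ s, ∀ j ∈ s, i ≠ j → Disjoint (C i) (C j)) (hdisjA : ∀ i ∈ s, Disjoint A (C i))
    (hup : ∀ i ∈ s, IsUpperSet (A ∪ C i)) (hupA : IsUpperSet A)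
    (hB : ∀ ω, ω ∈ B ↔ ω ∉ A ∧ ∀ i ∈ s, ω ∉ C i)
    (hA : DeterminedBy A (↑(insert e F') : Set ι)) (hC : ∀ i ∈ s, DeterminedBy (C i) (↑(insert e F') : Set ι)) :
    ∃ u v t : κ → ℝ, (∀ i ∈ s, 0 ≤ v i) ∧ (∀ i ∈ s, 0 ≤ t i) ∧
      (∀ i ∈ s, (prodBernoulli p).real (insert e ⁻¹' C i) = u i + v i) ∧
      (∀ i ∈ s, (prodBernoulli p).real ((· \ {e}) ⁻¹' C i) = u i + t i) ∧
      (prodBernoulli p).real ((· \ {e}) ⁻¹' A) + ∑ i ∈ s, t i ≤ (prodBernoulli p).real (insert e ⁻¹' A) ∧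
      (prodBernoulli p).real (insert e ⁻¹' B) + ∑ i ∈ s, v i ≤ (prodBernoulli p).real ((· \ {e}) ⁻¹' B) := by
  set μ := prodBernoulli p with hμ
  set A₁ := insert e ⁻¹' A with hA₁d
  set A₀ := (· \ {e}) ⁻¹' A with hA₀d
  set B₁ := insert e ⁻¹' B with hB₁d
  set B₀ := (· \ {e}) ⁻¹' B with hB₀d
  set C₁ : κ → Set (Set ι) := fun i => insert e ⁻¹' C i with hC₁d
  set C₀ : κ → Set (Set ι) := fun i => (· \ {e}) ⁻¹' C i with hC₀d
  have hle : ∀ ω : Set ι, ω \ {e} ≤ insert e ω := fun ω =>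
    (Set.sdiff_subset).trans (Set.subset_insert e ω)
  have hBdet : DeterminedBy B (↑(insert e F') : Set ι) := determinedBy_bottom hB hA hC
  have hA₁ : DeterminedBy A₁ (↑F' : Set ι) := determinedBy_preimage_insert hA
  have hB₀ : DeterminedBy B₀ (↑F' : Set ι) := determinedBy_preimage_sdiff hBdet
  have hC₁ : ∀ i ∈ s, DeterminedBy (C₁ i) (↑F' : Set ι) := fun i hi =>
    determinedBy_preimage_insert (hC i hi)
  have hC₀ : ∀ i ∈ s, DeterminedBy (C₀ i) (↑F' : Set ι) := fun i hi =>
    determinedBy_preimage_sdiff (hC i hi)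
  have mA₁ : MeasurableSet A₁ := hA₁.measurableSet_of_finset
  have mB₀ : MeasurableSet B₀ := hB₀.measurableSet_of_finset
  have mC₁ : ∀ i ∈ s, MeasurableSet (C₁ i) := fun i hi => (hC₁ i hi).measurableSet_of_finset
  have mC₀ : ∀ i ∈ s, MeasurableSet (C₀ i) := fun i hi => (hC₀ i hi).measurableSet_of_finset
  set u : κ → ℝ := fun i => μ.real (C₁ i ∩ C₀ i) with hu
  set v : κ → ℝ := fun i => μ.real (C₁ i ∩ B₀) with hv
  set t : κ → ℝ := fun i => μ.real (C₀ i ∩ A₁) with ht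
  have hBC : ∀ i ∈ s, Disjoint B (C i) := fun i hi =>
    Set.disjoint_left.2 fun ω hω hCω => ((hB ω).1 hω).2 i hi hCω
  refine ⟨u, v, t, fun i _ => measureReal_nonneg, fun i _ => measureReal_nonneg, ?_, ?_, ?_, ?_⟩
  · -- `μ(C_i¹) = u_i + v_i`
    intro i hi
    have hset : C₁ i = (C₁ i ∩ C₀ i) ∪ (C₁ i ∩ B₀) := by
      ext ω
      simp only [Set.mem_union, Set.mem_inter_iff, hC₁d, hC₀d, hB₀d, Set.mem_preimage]
      constructor
      · intro hω
        rcases bottom_or_same_of_le hdisj hdisjA hup hupA hB hi (hle ω) hω with hB' | hC'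
        · exact Or.inr ⟨hω, hB'⟩
        · exact Or.inl ⟨hω, hC'⟩
      · rintro (⟨h1, -⟩ | ⟨h1, -⟩) <;> exact h1
    have hd : Disjoint (C₁ i ∩ C₀ i) (C₁ i ∩ B₀) :=
      Set.disjoint_left.2 fun ω h1 h2 => Set.disjoint_left.1 (hBC i hi) h2.2 h1.2
    change μ.real (C₁ i) = u i + v i
    rw [hu, hv]
    simp only
    rw [← measureReal_union hd ((mC₁ i hi).inter mB₀) (measure_ne_top _ _) (measure_ne_top _ _),
      ← hset]
  · -- `μ(C_i⁰) = u_i + t_i`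
    intro i hi
    have hset : C₀ i = (C₁ i ∩ C₀ i) ∪ (C₀ i ∩ A₁) := by
      ext ω
      simp only [Set.mem_union, Set.mem_inter_iff, hC₁d, hC₀d, hA₁d, Set.mem_preimage]
      constructor
      · intro hω
        rcases hup i hi (hle ω) (Or.inr hω) with hA' | hC'
        · exact Or.inr ⟨hω, hA'⟩
        · exact Or.inl ⟨hC', hω⟩
      · rintro (⟨-, h1⟩ | ⟨h1, -⟩) <;> exact h1
    have hd : Disjoint (C₁ i ∩ C₀ i) (C₀ i ∩ A₁) :=
      Set.disjoint_left.2 fun ω h1 h2 => Set.disjoint_left.1 (hdisjA i hi) h2.2 h1.1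
    change μ.real (C₀ i) = u i + t i
    rw [hu, ht]
    simp only
    rw [← measureReal_union hd ((mC₀ i hi).inter mA₁) (measure_ne_top _ _) (measure_ne_top _ _),
      ← hset]
  · -- `μ(A⁰) + Σ t ≤ μ(A¹)`
    have hsub : A₀ ∪ ⋃ i ∈ s, (C₀ i ∩ A₁) ⊆ A₁ :=
      Set.union_subset (fun ω hω => hupA (hle ω) hω)
        (Set.iUnion₂_subset fun i _ => Set.inter_subset_right)
    have hpd : (↑s : Set κ).PairwiseDisjoint fun i => C₀ i ∩ A₁ :=
      fun i hi j hj hij => Set.disjoint_left.2 fun ω h1 h2 =>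
        Set.disjoint_left.1 (hdisj i (Finset.mem_coe.1 hi) j (Finset.mem_coe.1 hj) hij) h1.1 h2.1
    have hd0 : Disjoint A₀ (⋃ i ∈ s, (C₀ i ∩ A₁)) := by
      refine Set.disjoint_left.2 fun ω h1 h2 => ?_
      simp only [Set.mem_iUnion, Set.mem_inter_iff, exists_prop] at h2
      obtain ⟨i, hi, h3, -⟩ := h2
      exact Set.disjoint_left.1 (hdisjA i hi) h1 h3
    have hmU : MeasurableSet (⋃ i ∈ s, (C₀ i ∩ A₁)) :=
      Finset.measurableSet_biUnion s fun i hi => (mC₀ i hi).inter mA₁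
    calc μ.real A₀ + ∑ i ∈ s, t i
        = μ.real (A₀ ∪ ⋃ i ∈ s, (C₀ i ∩ A₁)) := by
          rw [measureReal_union hd0 hmU (measure_ne_top _ _) (measure_ne_top _ _),
            measureReal_biUnion_finset hpd (fun i hi => (mC₀ i hi).inter mA₁)
            (fun i _ => measure_ne_top _ _)]
      _ ≤ μ.real A₁ := measureReal_mono hsub (measure_ne_top _ _)
  · -- `μ(B¹) + Σ v ≤ μ(B⁰)`
    have hlow : IsLowerSet B := isLowerSet_bottom hup hupA hB
    have hsub : B₁ ∪ ⋃ i ∈ s, (C₁ i ∩ B₀) ⊆ B₀ :=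
      Set.union_subset (fun ω hω => hlow (hle ω) hω)
        (Set.iUnion₂_subset fun i _ => Set.inter_subset_right)
    have hpd : (↑s : Set κ).PairwiseDisjoint fun i => C₁ i ∩ B₀ :=
      fun i hi j hj hij => Set.disjoint_left.2 fun ω h1 h2 =>
        Set.disjoint_left.1 (hdisj i (Finset.mem_coe.1 hi) j (Finset.mem_coe.1 hj) hij) h1.1 h2.1
    have hd0 : Disjoint B₁ (⋃ i ∈ s, (C₁ i ∩ B₀)) := by
      refine Set.disjoint_left.2 fun ω h1 h2 => ?_
      simp only [Set.mem_iUnion, Set.mem_inter_iff, exists_prop] at h2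
      obtain ⟨i, hi, h3, -⟩ := h2
      exact Set.disjoint_left.1 (hBC i hi) h1 h3
    have hmU : MeasurableSet (⋃ i ∈ s, (C₁ i ∩ B₀)) :=
      Finset.measurableSet_biUnion s fun i hi => (mC₁ i hi).inter mB₀
    calc μ.real B₁ + ∑ i ∈ s, v i
        = μ.real (B₁ ∪ ⋃ i ∈ s, (C₁ i ∩ B₀)) := by
          rw [measureReal_union hd0 hmU (measure_ne_top _ _) (measure_ne_top _ _),
            measureReal_biUnion_finset hpd (fun i hi => (mC₁ i hi).inter mB₀)
            (fun i _ => measure_ne_top _ _)]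
      _ ≤ μ.real B₀ := measureReal_mono hsub (measure_ne_top _ _)

/-! ### The induction on the set of coordinates, for pairs of systems -/

/-- A single Gladkov system satisfies the cross-condition with itself: `ω' ≤ ω ∈ C i` and
`ω' ∈ C j` would put `ω ∈ A ∪ C j`, contradicting disjointness. [this work] -/
theorem cross_self {κ : Type*} {s : Finset κ} {A : Set (Set ι)} {C : κ → Set (Set ι)}
    (hdisj : ∀ i ∈ s, ∀ j ∈ s, i ≠ j → Disjoint (C i) (C j)) (hdisjA : ∀ i ∈ s, Disjoint A (C i))
    (hup : ∀ i ∈ s, IsUpperSet (A ∪ C i)) :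
    ∀ i ∈ s, ∀ j ∈ s, i ≠ j → ∀ ω ω' : Set ι, ω' ≤ ω → ω ∈ C i → ω' ∉ C j := by
  intro i hi j hj hij ω ω' hle hω hω'
  rcases hup j hj hle (Or.inr hω') with hA | hC
  · exact Set.disjoint_left.1 (hdisjA i hi) hA hω
  · exact Set.disjoint_left.1 (hdisj i hi j hj hij) hω hC

/-- The cross-condition passes to sections (upper/lower in any combination with the `C`-side at
least as high: here upper–upper, lower–lower and upper–lower). [this work] -/
theorem cross_sections {κ : Type*} {s : Finset κ} {C C' : κ → Set (Set ι)} (e : ι)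
    (h : ∀ i ∈ s, ∀ j ∈ s, i ≠ j → ∀ ω ω' : Set ι, ω' ≤ ω → ω ∈ C i → ω' ∉ C' j) :
    (∀ i ∈ s, ∀ j ∈ s, i ≠ j → ∀ ω ω' : Set ι, ω' ≤ ω → ω ∈ insert e ⁻¹' C i → ω' ∉ insert e ⁻¹' C' j) ∧
    (∀ i ∈ s, ∀ j ∈ s, i ≠ j → ∀ ω ω' : Set ι, ω' ≤ ω →
      ω ∈ (· \ {e}) ⁻¹' C i → ω' ∉ (· \ {e}) ⁻¹' C' j) ∧
    (∀ i ∈ s, ∀ j ∈ s, i ≠ j → ∀ ω ω' : Set ι, ω' ≤ ω →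
      ω ∈ insert e ⁻¹' C i → ω' ∉ (· \ {e}) ⁻¹' C' j) := by
  refine ⟨?_, ?_, ?_⟩
  · intro i hi j hj hij ω ω' hle hω hω'
    exact h i hi j hj hij (insert e ω) (insert e ω') (Set.insert_subset_insert hle) hω hω'
  · intro i hi j hj hij ω ω' hle hω hω'
    exact h i hi j hj hij (ω \ {e}) (ω' \ {e}) (Set.sdiff_subset_sdiff_left hle) hω hω'
  · intro i hi j hj hij ω ω' hle hω hω'
    exact h i hi j hj hij (insert e ω) (ω' \ {e})
      ((Set.sdiff_subset).trans (hle.trans (Set.subset_insert e ω))) hω hω'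


end MonotonePolarizedStrongHarris

end Summit.CriticalPhenomena.PercolationContinuityZ3.Theorems

end
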